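import Summits.AtomisticToContinuum.Crystallization.Theses.ChessboardParticlePlanes
import Summits.AtomisticToContinuum.Crystallization.Theorems.ChessboardParticlePlanesLjBilayerHcpNormalForm
import Summits.AtomisticToContinuum.Crystallization.Theorems.PricedLinkCensusStackingHingeHcpEnergyMinOnBox
import Summits.AtomisticToContinuum.Crystallization.Theorems.ChessboardParticlePlanesLjBilayerHcpStubNumeric

/-!
# Crux `ChessboardParticlePlanes.LjBilayerHcp` (stmt-AtomisticToContinuum-6710), line `Sketch` —
# the crux REDUCES TO ITS STRUCTURAL CORE Sσ (witness-free, box-free)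

With the numeric face proved (`stub_numeric`, file `…StubNumeric.lean`), the normal form (`ljBilayerHcp_of_normalForm`,
p117119) and the argmin of `e ∘ hcp` on the box (`PricedHcpWindowsHcpBox.stub_hcpEnergyMinOnBox`, proved in the tree),
the crux `LjBilayerHcp` follows from — and is the natural target form of — the STRUCTURAL statement

  Sσ: for every `c ≥ 3/4` and every `2/3`-separated NORMAL period-2 stack `B` (`2c e₃ ∈ B.lattice`, periods with heights in
      `2cℤ`, points with heights in `cℤ`) there is an hcp of the class, `a ≥ 2/3`, `h ≥ 3/4`, with `e(hcp a h) ≤ e(B)`.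

`ljBilayerHcp_of_structural : Sσ → LjBilayerHcp` is the transfer any future line for this crux should use: Sσ is the pure
two-species planar crystallization content (hcp optimal among period-2 stacks of its own class), with no box and no
witness to pin.  [folklore]
-/

noncomputable section

open Literature.MathematicalPhysics.StatisticalMechanics

namespace Summit.AtomisticToContinuum.Crystallization.Theorems.LjBilayerHcpSketch

/-- **The crux from its structural core** (registered sub-goal `ljBilayerHcp_of_structural` of line `Sketch`): if every
`2/3`-separated normal period-2 stack with spacing `c ≥ 3/4` is beaten by some hcp of the class (`a ≥ 2/3`, `h ≥ 3/4`),
then `LjBilayerHcp` holds — the argmin of `e ∘ hcp` on the box beats every box-hcp (`stub_hcpEnergyMinOnBox`), which beats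
every class-hcp (`stub_numeric`), which beats `B`; `ljBilayerHcp_of_normalForm` undoes the normal form. [folklore] -/
theorem ljBilayerHcp_of_structural :
    (∀ c : ℝ, 3 / 4 ≤ c → ∀ B : PeriodicConfiguration 3,
      (∀ x ∈ B.points, ∀ y ∈ B.points, x ≠ y → (2 : ℝ) / 3 ≤ dist x y) →
      (2 * c) • EuclideanSpace.single (2 : Fin 3) (1 : ℝ) ∈ B.lattice →
      (∀ g ∈ B.lattice, ∃ k : ℤ, g 2 = 2 * c * (k : ℝ)) →
      (∀ x ∈ B.points, ∃ k : ℤ, x 2 = c * (k : ℝ)) →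
      ∃ a h : ℝ, ∃ (ha : a ≠ 0) (hh : h ≠ 0), 2 / 3 ≤ a ∧ 3 / 4 ≤ h ∧
        (hcpPeriodicConfiguration ha hh).energyPerParticle lennardJones ≤
          B.energyPerParticle lennardJones) →
    Summit.AtomisticToContinuum.Crystallization.Theses.ChessboardParticlePlanes.LjBilayerHcp := by
  intro hS
  obtain ⟨a₀, h₀, ha₀, hh₀, b1, b2, b3, b4, hmin⟩ :=
    Summit.AtomisticToContinuum.Crystallization.Theorems.PricedHcpWindowsHcpBox.stub_hcpEnergyMinOnBox
  refine ljBilayerHcp_of_normalForm ⟨a₀, h₀, ha₀, hh₀, b1, b2, b3, b4, fun c hc B hsep h2c hL hpts => ?_⟩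
  obtain ⟨a, h, ha, hh, ha23, hh34, hle⟩ := hS c hc B hsep h2c hL hpts
  obtain ⟨a', h', ha', hh', c1, c2, c3, c4, hle'⟩ := stub_numeric a h ha hh ha23 hh34
  exact (hmin a' h' ha' hh' c1 c2 c3 c4).trans (hle'.trans hle)

end Summit.AtomisticToContinuum.Crystallization.Theorems.LjBilayerHcpSketch

end
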